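import Summits.BirchSwinnertonDyer.BirchSwinnertonDyer.Theorems.PrintCf2RamifiedOffTYZSquareSilenceCoefficients
import Summits.BirchSwinnertonDyer.BirchSwinnertonDyer.Theorems.PrintCf2RamifiedOffTYZLowerHalfTwoPrimesEvenOfDisplays
import Summits.BirchSwinnertonDyer.BirchSwinnertonDyer.Theorems.PrintCf2RamifiedOffTYZFrobeniusPairWitness
import Literature.NumberTheory.EllipticCurves.TianYuanZhang2017.CMPointFrobeniusValueDisplays
import HarnessLib

/-!
# Crux `PrintCf2.RamifiedOffTYZOfFacts` (stmt-BirchSwinnertonDyer-20509), line `offtyz-v7`, LEAD cycle 13 (cruxlead-20509 g12):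
# THE FIRST THREE-PRIME EVEN CELL — `n = 6pq`, `p ≡ q ≡ 1 (mod 24)`, `(p/q) = −1` (`#Sel₂(E_n) = 2⁵`): the top witness is the PAIR `φ_pφ_q`, the
# proper even blocks carry even coefficients, and the LOWER HALF of C⁺ follows from the named facts

THEOREMS ONLY (no `def`, no named fact, no `sorry`), `--supports stmt-BirchSwinnertonDyer-20509` (item 23431 = C⁺, even three-prime sector).  The k = 3
demonstration of the cycle-13 machine (`…SquareSilenceCoefficients` p735302, `…FrobeniusPairWitness` p736078, `…LowerHalfTwoPrimesEvenOfDisplays` p733790):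
* §1 sign bookkeeping with ONE negated factor (`apply_sqrtNeg_eq_neg_of_mul`, `…_of_mul'`);
* §2 the divisors of `6pq` (`p, q ≡ 1 (8)`): none `≡ 5 (mod 8)`, those `≡ 6` are `6, 6p, 6q, 6pq` (`divisors_six_mul`);
* §3 `trivialOnL_pair`: for `p ≡ q ≡ 1 (mod 24)`, `(p/q) = −1`, the Frobenius elements `φ_p, φ_q` of the top block each fix `i, √−2, √−3` (Euler: `(−1/p) =
  (−2/p) = (−3/p) = 1`), `φ_p` negates `√−q` (`(−q/p) = (p/q) = −1`) and — fixing `√−n` — also `√−p` (§1); so the PRODUCT is trivial on `L_n(i)` while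
  neither factor is (no single witness exists on this cell);
* §4 `two_dvd_scriptL_six_pq_of_valuePrinted` / ★ **`two_dvd_scriptL_six_pq_of_facts : (tyz_cmPointRingClassFrobeniusValueData ∧ thm11_parity_of_scriptL ∧
  GZK) → ∀ n p q, Squarefree n → p, q prime → p ≠ q → n = 6pq → p ≡ q ≡ 1 (24) → jacobiSym p q = −1 → r_an(E_n) = 1 → ∀ generator (x, y) of E_n(ℚ)/tors,
  x ∉ {±1,±2,±n,±2n}ℚ² → ∀ L, IsScriptL n L → 2 ∣ L`** — the lower half of C⁺ on this cell (coefficient-aware silence: top pair witness with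
  `(φ_pφ_q)² ∈ Γ′`, `φ_pφ_q ∉ Γ_H` since `[𝔭_p][𝔭_q] ≠ 1`; blocks `6p`, `6q` with even `|𝓛(q)|`, `|𝓛(p)|`; block `6` automatic; no block `≡ 5`).
The cell is in the even jump-one class: Monsky's even matrix for `(3, p, q)` with these symbols has rank `3`, `s(n) = 3` (LEAD census; first member
`n = 84534 = 2·3·73·193`).  Beyond-print theorem: YES (conditional on the three named facts).  BSD is not proved by any of this; no class is closed.

References: [cite: TianYuanZhang2017, Thm. 1.1, §1 (p0002 L101–L110), §3.1 (p0011 L1–L73), Prop. 3.2 (2), Thm. 3.5, Thm. 3.6 (2), Lemma 3.18, proof of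
Lemma 3.21]; [cite: Cox2013, §5.C Lemma 5.19, (5.22), Thm. 5.23, Cor. 5.25, §9.A, §1 (1.13)–(1.15)]; [cite: HeathBrown1994SelmerCongruentII, §1, Appendix
(Monsky)]; [cite: Stevenhagen1995RedeiMatrices, §2]; [cite: Darmon2004, Thm. 3.22].
-/

noncomputable section

open scoped Classical

open WeierstrassCurve WeierstrassCurve.Affine Finset Literature.NumberTheory.EllipticCurves
  Literature.NumberTheory.EllipticCurves.TianYuanZhang2017
  Literature.NumberTheory.EllipticCurves.TianYuanZhang2017.W2
  Summit.BirchSwinnertonDyer.Rank1Residual.P2.GenusPeriodTransferLayer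
  Summit.BirchSwinnertonDyer.Rank1Residual.P2
  Summit.BirchSwinnertonDyer.PrintCf2.MoverAssembly
  Summit.BirchSwinnertonDyer.PrintCf2.SquareSilenceEven
  Summit.BirchSwinnertonDyer.PrintCf2.SquareSilenceCoefficients
  Summit.BirchSwinnertonDyer.PrintCf2.FrobeniusPairWitness
  Summit.BirchSwinnertonDyer.PrintCf2.LowerHalfTwoPrimesEvenDisplays

set_option autoImplicit false

namespace Summit.BirchSwinnertonDyer.PrintCf2.SixPQ

variable {n : ℕ} (D : GenusPointData n)

/-! ## §1 Sign bookkeeping: one negated factor -/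

/-- An automorphism fixing `i` and `√−(ab)` and NEGATING `√−b` negates `√−a`. [cite: TianYuanZhang2017, §3.1 (p0011 L60–L64)] -/
theorem apply_sqrtNeg_eq_neg_of_mul {a b : ℕ} (ha : a ∈ n.divisors) (hb : b ∈ n.divisors) (hab : a * b ∈ n.divisors)
    {φ : D.H ≃ₐ[ℚ] D.H} (hφi : φ D.im = D.im) (hφab : φ (D.sqrtNeg (a * b)) = D.sqrtNeg (a * b))
    (hφb : φ (D.sqrtNeg b) = -D.sqrtNeg b) : φ (D.sqrtNeg a) = -D.sqrtNeg a := by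
  have hb0 : D.sqrtNeg b ≠ 0 := D.sqrtNeg_ne_zero hb
  have h1 : φ (D.sqrtNeg a * D.sqrtNeg b) = D.sqrtNeg a * D.sqrtNeg b := by
    rcases eq_or_eq_neg_of_sq_eq_sq' (sqrtNeg_mul_sq D ha hb hab).symm with e | e
    · rw [← e, map_mul, hφi, hφab]
    · rw [show D.sqrtNeg a * D.sqrtNeg b = -(D.im * D.sqrtNeg (a * b)) by rw [e, neg_neg], map_neg, map_mul, hφi, hφab]
  rw [map_mul, hφb] at h1
  have h2 : (φ (D.sqrtNeg a) + D.sqrtNeg a) * D.sqrtNeg b = 0 := by linear_combination -h1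
  rcases mul_eq_zero.mp h2 with h | h
  · linear_combination h
  · exact absurd h hb0

/-- An automorphism fixing `i` and `√−a` and NEGATING `√−(ab)` negates `√−b`. [cite: TianYuanZhang2017, §3.1 (p0011 L60–L64)] -/
theorem apply_sqrtNeg_eq_neg_of_mul' {a b : ℕ} (ha : a ∈ n.divisors) (hb : b ∈ n.divisors) (hab : a * b ∈ n.divisors)
    {φ : D.H ≃ₐ[ℚ] D.H} (hφi : φ D.im = D.im) (hφa : φ (D.sqrtNeg a) = D.sqrtNeg a)
    (hφab : φ (D.sqrtNeg (a * b)) = -D.sqrtNeg (a * b)) : φ (D.sqrtNeg b) = -D.sqrtNeg b := by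
  have ha0 : D.sqrtNeg a ≠ 0 := D.sqrtNeg_ne_zero ha
  have h1 : φ (D.sqrtNeg a * D.sqrtNeg b) = -(D.sqrtNeg a * D.sqrtNeg b) := by
    rcases eq_or_eq_neg_of_sq_eq_sq' (sqrtNeg_mul_sq D ha hb hab).symm with e | e
    · rw [← e, map_mul, hφi, hφab]; ring
    · rw [show D.sqrtNeg a * D.sqrtNeg b = -(D.im * D.sqrtNeg (a * b)) by rw [e, neg_neg], map_neg, map_mul, hφi, hφab]; ring
  rw [map_mul, hφa] at h1
  have h2 : D.sqrtNeg a * (φ (D.sqrtNeg b) + D.sqrtNeg b) = 0 := by linear_combination h1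
  rcases mul_eq_zero.mp h2 with h | h
  · exact absurd h ha0
  · linear_combination h

/-! ## §2 Divisors of `n = 6pq`, `p ≡ q ≡ 1 (mod 8)` -/

/-- A divisor of `2m` is odd and divides `m`, or twice a divisor of `m`. [folklore] -/
theorem dvd_or_two_mul_dvd_of_dvd_two_mul {m d : ℕ} (hd : d ∣ 2 * m) : d ∣ m ∨ ∃ d', d = 2 * d' ∧ d' ∣ m := by
  rcases Nat.even_or_odd d with ⟨d', hd'⟩ | hodd
  · refine Or.inr ⟨d', by omega, ?_⟩
    have : 2 * d' ∣ 2 * m := by rw [two_mul, ← hd']; exact hd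
    exact Nat.dvd_of_mul_dvd_mul_left two_pos this
  · have hcop : Nat.Coprime d 2 := (Nat.Prime.coprime_iff_not_dvd Nat.prime_two).mpr (fun h2 =>
      (Nat.not_even_iff_odd.mpr hodd) (even_iff_two_dvd.mpr h2)) |>.symm
    exact Or.inl (hcop.dvd_of_dvd_mul_left hd)

/-- **Residues of the divisors of `6pq`** (`p, q` primes `≡ 1 (mod 8)`): a divisor `≡ 6 (mod 8)` is `6, 6p, 6q` or `6pq`; none is `≡ 5 (mod 8)`.
[cite: TianYuanZhang2017, §3.1 (p0011 L67–L70)] -/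
theorem divisors_six_mul {p q : ℕ} (hp : Nat.Prime p) (hq : Nat.Prime q) (hp8 : p % 8 = 1) (hq8 : q % 8 = 1) {d : ℕ} (hd : d ∣ 2 * 3 * p * q) :
    d % 8 ≠ 5 ∧ (d % 8 = 6 → d = 2 * 3 ∨ d = 2 * 3 * p ∨ d = 2 * 3 * q ∨ d = 2 * 3 * p * q) := by
  have hd' : d ∣ 2 * (3 * p * q) := by rw [show 2 * (3 * p * q) = 2 * 3 * p * q by ring]; exact hd
  have h3p : (3 * p) % 8 = 3 := by rw [Nat.mul_mod, hp8]
  have h3q : (3 * q) % 8 = 3 := by rw [Nat.mul_mod, hq8]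
  have hpq : (p * q) % 8 = 1 := by rw [Nat.mul_mod, hp8, hq8]
  have h3pq : (3 * p * q) % 8 = 3 := by rw [Nat.mul_mod, h3p, hq8]
  rcases dvd_or_two_mul_dvd_of_dvd_two_mul hd' with h | ⟨d', rfl, h⟩
  · rcases (dvd_mul_three_iff Nat.prime_three hp hq).mp h with rfl | rfl | rfl | rfl | rfl | rfl | rfl | rfl <;> omega
  · rcases (dvd_mul_three_iff Nat.prime_three hp hq).mp h with rfl | rfl | rfl | rfl | rfl | rfl | rfl | rfl
    · omega
    · exact ⟨by omega, fun _ => Or.inl rfl⟩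
    · omega
    · omega
    · exact ⟨by omega, fun _ => Or.inr (Or.inl (by ring))⟩
    · exact ⟨by omega, fun _ => Or.inr (Or.inr (Or.inl (by ring)))⟩
    · omega
    · exact ⟨by omega, fun _ => Or.inr (Or.inr (Or.inr (by ring)))⟩

/-! ## §3 The pair `φ_pφ_q` is trivial on `L_n(i)` for `n = 6pq`, `p ≡ q ≡ 1 (mod 24)`, `(p/q) = −1` -/

/-- `(−3/p) = 1` for a prime `p ≡ 1 (mod 12)`. [cite: Cox2013, §1 (1.13)–(1.15)] -/
theorem jacobiSym_neg_three_eq_one {p : ℕ} (hp : p.Prime) (hp12 : p % 12 = 1) : jacobiSym (-3) p = 1 := by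
  have hodd : Odd p := hp.odd_of_ne_two (by omega)
  rw [show (-3 : ℤ) = -1 * 3 by norm_num, jacobiSym.mul_left, jacobiSym_neg_one_eq_one hp (by omega), one_mul,
    show (3 : ℤ) = ((3 : ℕ) : ℤ) by norm_num,
    jacobiSym.quadratic_reciprocity_one_mod_four' (by decide : Odd 3) (by omega : p % 4 = 1), jacobiSym.mod_left,
    show ((p : ℤ) % (3 : ℕ)) = 1 by omega, jacobiSym.one_left]

/-- **The Frobenius pair `φ_pφ_q` of `n = 6pq` is trivial on `L_n(i)`** when `p ≡ q ≡ 1 (mod 24)` and `(p/q) = −1`: each factor fixes `i, √−2, √−3`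
(Euler: `(−1/p) = (−2/p) = (−3/p) = 1`), moves the other prime's `√−r` (`(−q/p) = (p/q) = −1`) and — since it fixes `√−n` — its own (`§1`), so the
product fixes everything. [cite: TianYuanZhang2017, §3.1 (p0011 L60–L66), Prop. 3.2 (2)] [cite: Cox2013, §5.C (5.22), §1 (1.13)–(1.15)] -/
theorem trivialOnL_pair (hsq : Squarefree n) {p q : ℕ} (hp : p.Prime) (hq : q.Prime) (hpq : p ≠ q) (hn : n = 2 * 3 * p * q)
    (hp24 : p % 24 = 1) (hq24 : q % 24 = 1) (hleg : jacobiSym p q = -1)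
    {φ₁ φ₂ : D.H ≃ₐ[ℚ] D.H}
    (h₁K : φ₁ (D.sqrtNeg n) = D.sqrtNeg n) (h₁i : φ₁ D.im = (jacobiSym (-1) p) • D.im)
    (h₁r : ∀ r : ℕ, r.Prime → r ∣ n → r ≠ p → φ₁ (D.sqrtNeg r) = (jacobiSym (-(r : ℤ)) p) • D.sqrtNeg r)
    (h₂K : φ₂ (D.sqrtNeg n) = D.sqrtNeg n) (h₂i : φ₂ D.im = (jacobiSym (-1) q) • D.im)
    (h₂r : ∀ r : ℕ, r.Prime → r ∣ n → r ≠ q → φ₂ (D.sqrtNeg r) = (jacobiSym (-(r : ℤ)) q) • D.sqrtNeg r) :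
    D.TrivialOnL n (φ₁ * φ₂) := by
  have hn0 : n ≠ 0 := hsq.ne_zero
  have hm : ∀ {d : ℕ}, d ∣ n → d ∈ n.divisors := fun hd => Nat.mem_divisors.mpr ⟨hd, hn0⟩
  have hp2 : p ≠ 2 := by omega
  have hq2 : q ≠ 2 := by omega
  have hp3 : p ≠ 3 := by omega
  have hq3 : q ≠ 3 := by omega
  -- divisibility bookkeeping
  have d2 : 2 ∣ n := ⟨3 * p * q, by rw [hn]; ring⟩
  have d3 : 3 ∣ n := ⟨2 * p * q, by rw [hn]; ring⟩
  have dp : p ∣ n := ⟨2 * 3 * q, by rw [hn]; ring⟩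
  have dq : q ∣ n := ⟨2 * 3 * p, by rw [hn]; ring⟩
  have d6 : 2 * 3 ∣ n := ⟨p * q, by rw [hn]; ring⟩
  have d6p : 2 * 3 * p ∣ n := ⟨q, by rw [hn]⟩
  have d6q : 2 * 3 * q ∣ n := ⟨p, by rw [hn]; ring⟩
  have hn' : 2 * 3 * p * q ∈ n.divisors := by rw [← hn]; exact Nat.mem_divisors_self n hn0
  have hn'' : 2 * 3 * q * p ∈ n.divisors := by rw [show 2 * 3 * q * p = n by rw [hn]; ring]; exact Nat.mem_divisors_self n hn0
  -- Legendre values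
  have hqp : jacobiSym q p = -1 := by
    rw [jacobiSym.quadratic_reciprocity_one_mod_four' (hq.odd_of_ne_two hq2) (by omega : p % 4 = 1)]; exact hleg
  have v1i : jacobiSym (-1) p = 1 := jacobiSym_neg_one_eq_one hp (by omega)
  have v2i : jacobiSym (-1) q = 1 := jacobiSym_neg_one_eq_one hq (by omega)
  -- actions of `φ₁`
  have a1i : φ₁ D.im = D.im := by rw [h₁i, v1i, one_smul]
  have a12 : φ₁ (D.sqrtNeg 2) = D.sqrtNeg 2 := by
    rw [h₁r 2 Nat.prime_two d2 hp2.symm, show (-((2 : ℕ) : ℤ)) = -2 by norm_num, jacobiSym_neg_two_eq_one hp (by omega), one_smul]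
  have a13 : φ₁ (D.sqrtNeg 3) = D.sqrtNeg 3 := by
    rw [h₁r 3 Nat.prime_three d3 hp3.symm, show (-((3 : ℕ) : ℤ)) = -3 by norm_num, jacobiSym_neg_three_eq_one hp (by omega), one_smul]
  have a1q : φ₁ (D.sqrtNeg q) = -D.sqrtNeg q := by
    rw [h₁r q hq dq hpq.symm, neg_eq_neg_one_mul, jacobiSym.mul_left, v1i, one_mul, hqp, neg_one_smul]
  -- actions of `φ₂`
  have a2i : φ₂ D.im = D.im := by rw [h₂i, v2i, one_smul]
  have a22 : φ₂ (D.sqrtNeg 2) = D.sqrtNeg 2 := by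
    rw [h₂r 2 Nat.prime_two d2 hq2.symm, show (-((2 : ℕ) : ℤ)) = -2 by norm_num, jacobiSym_neg_two_eq_one hq (by omega), one_smul]
  have a23 : φ₂ (D.sqrtNeg 3) = D.sqrtNeg 3 := by
    rw [h₂r 3 Nat.prime_three d3 hq3.symm, show (-((3 : ℕ) : ℤ)) = -3 by norm_num, jacobiSym_neg_three_eq_one hq (by omega), one_smul]
  have a2p : φ₂ (D.sqrtNeg p) = -D.sqrtNeg p := by
    rw [h₂r p hp dp hpq, neg_eq_neg_one_mul, jacobiSym.mul_left, v2i, one_mul, hleg, neg_one_smul]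
  -- self-signs through `√−n`: `φ₁` negates `√−p`, `φ₂` negates `√−q`
  have a16 : φ₁ (D.sqrtNeg (2 * 3)) = D.sqrtNeg (2 * 3) := apply_sqrtNeg_mul_eq D (hm d2) (hm d3) (hm d6) a1i a12 a13
  have a26 : φ₂ (D.sqrtNeg (2 * 3)) = D.sqrtNeg (2 * 3) := apply_sqrtNeg_mul_eq D (hm d2) (hm d3) (hm d6) a2i a22 a23
  have h₁K' : φ₁ (D.sqrtNeg (2 * 3 * p * q)) = D.sqrtNeg (2 * 3 * p * q) := by rw [← hn]; exact h₁K
  have h₂K' : φ₂ (D.sqrtNeg (2 * 3 * q * p)) = D.sqrtNeg (2 * 3 * q * p) := by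
    rw [show 2 * 3 * q * p = n by rw [hn]; ring]; exact h₂K
  have a16p : φ₁ (D.sqrtNeg (2 * 3 * p)) = -D.sqrtNeg (2 * 3 * p) := apply_sqrtNeg_eq_neg_of_mul D (hm d6p) (hm dq) hn' a1i h₁K' a1q
  have a1p : φ₁ (D.sqrtNeg p) = -D.sqrtNeg p := apply_sqrtNeg_eq_neg_of_mul' D (hm d6) (hm dp) (hm d6p) a1i a16 a16p
  have a26q : φ₂ (D.sqrtNeg (2 * 3 * q)) = -D.sqrtNeg (2 * 3 * q) := apply_sqrtNeg_eq_neg_of_mul D (hm d6q) (hm dp) hn'' a2i h₂K' a2p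
  have a2q : φ₂ (D.sqrtNeg q) = -D.sqrtNeg q := apply_sqrtNeg_eq_neg_of_mul' D (hm d6) (hm dq) (hm d6q) a2i a26 a26q
  -- the product fixes `i, √−2, √−3, √−p, √−q`
  have ei : (φ₁ * φ₂) D.im = D.im := by rw [AlgEquiv.mul_apply, a2i, a1i]
  have e2 : (φ₁ * φ₂) (D.sqrtNeg 2) = D.sqrtNeg 2 := by rw [AlgEquiv.mul_apply, a22, a12]
  have e3 : (φ₁ * φ₂) (D.sqrtNeg 3) = D.sqrtNeg 3 := by rw [AlgEquiv.mul_apply, a23, a13]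
  have ep : (φ₁ * φ₂) (D.sqrtNeg p) = D.sqrtNeg p := by rw [AlgEquiv.mul_apply, a2p, map_neg, a1p, neg_neg]
  have eq' : (φ₁ * φ₂) (D.sqrtNeg q) = D.sqrtNeg q := by rw [AlgEquiv.mul_apply, a2q, map_neg, a1q, neg_neg]
  -- all divisors
  have F : ∀ {a b : ℕ}, a ∣ n → b ∣ n → a * b ∣ n → (φ₁ * φ₂) (D.sqrtNeg a) = D.sqrtNeg a →
      (φ₁ * φ₂) (D.sqrtNeg b) = D.sqrtNeg b → (φ₁ * φ₂) (D.sqrtNeg (a * b)) = D.sqrtNeg (a * b) :=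
    fun ha hb hab h1 h2 => apply_sqrtNeg_mul_eq D (hm ha) (hm hb) (hm hab) ei h1 h2
  have d3p : 3 * p ∣ n := ⟨2 * q, by rw [hn]; ring⟩
  have d3q : 3 * q ∣ n := ⟨2 * p, by rw [hn]; ring⟩
  have dpq : p * q ∣ n := ⟨2 * 3, by rw [hn]; ring⟩
  have d3pq : 3 * p * q ∣ n := ⟨2, by rw [hn]; ring⟩
  have e3p := F d3 dp d3p e3 ep
  have e3q := F d3 dq d3q e3 eq'
  have epq := F dp dq dpq ep eq'
  have e3pq := F d3p dq d3pq e3p eq'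
  refine ⟨ei, fun d hd hd1 => ?_⟩
  have hdvd : d ∣ 2 * (3 * p * q) := by rw [show 2 * (3 * p * q) = n by rw [hn]; ring]; exact Nat.dvd_of_mem_divisors hd
  rcases dvd_or_two_mul_dvd_of_dvd_two_mul hdvd with h | ⟨d', rfl, h⟩
  · rcases (dvd_mul_three_iff Nat.prime_three hp hq).mp h with rfl | rfl | rfl | rfl | rfl | rfl | rfl | rfl
    · omega
    · exact e3
    · exact ep
    · exact eq'
    · exact e3p
    · exact e3q
    · exact epq
    · exact e3pq
  · rcases (dvd_mul_three_iff Nat.prime_three hp hq).mp h with rfl | rfl | rfl | rfl | rfl | rfl | rfl | rfl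
    · rw [mul_one]; exact e2
    · exact F d2 d3 d6 e2 e3
    · exact F d2 dp ⟨3 * q, by rw [hn]; ring⟩ e2 ep
    · exact F d2 dq ⟨3 * p, by rw [hn]; ring⟩ e2 eq'
    · exact F d2 d3p ⟨q, by rw [hn]; ring⟩ e2 e3p
    · exact F d2 d3q ⟨p, by rw [hn]; ring⟩ e2 e3q
    · exact F d2 dpq ⟨3, by rw [hn]; ring⟩ e2 epq
    · exact F d2 d3pq ⟨1, by rw [hn]; ring⟩ e2 e3pq

/-! ## §4 The cell theorem: square silence on the stabiliser and the lower half for `n = 6pq`, `p ≡ q ≡ 1 (mod 24)`, `(p/q) = −1` -/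

/-- **THE LOWER HALF OF C⁺ ON THE THREE-PRIME EVEN CELL `n = 6pq`, `p ≡ q ≡ 1 (mod 24)`, `(p/q) = −1`** (a cell of the even jump-one class:
`#Sel₂(E_n) = 2⁵` by Monsky), display shape over `D.Printed ∧ D.CMPointRingClassFrobeniusValuePrinted`: with GZK, analytic rank one, Thm 1.1 by name and a
generator `R = (x, y)` of `E_n(ℚ)` modulo torsion with `x ∉ {±1, ±2, ±n, ±2n}·ℚ^{×2}`, every `L` with `𝓛(n)² = L²` is EVEN.  Mechanism: the TOP block's
witness is the PAIR `φ_pφ_q` (§3; no single Frobenius is `L_n(i)`-trivial since `(q/p) = −1`), the proper even blocks `6p`, `6q` carry the even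
coefficients `|𝓛(q)|`, `|𝓛(p)|` (primes `≡ 1 (8)`), the block `6 = 2·3` is automatic, and no divisor is `≡ 5 (mod 8)` — `…SquareSilenceCoefficients`.
[cite: TianYuanZhang2017, Thm. 1.1, Thm. 3.5, Lemma 3.18, §3.1, Prop. 3.2 (2), Thm. 3.6 (2), proof of Lemma 3.21, §1 (p0002 L101–L110)]
[cite: Cox2013, §5.C Thm. 5.23, Cor. 5.25, (5.22), §9.A] [cite: HeathBrown1994SelmerCongruentII, §1, Appendix (Monsky)] [cite: Darmon2004, Thm. 3.22] -/
theorem two_dvd_scriptL_six_pq_of_valuePrinted (hGZK : rank_eq_analyticRank_of_analyticRank_le_one) (h11 : thm11_parity_of_scriptL)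
    (hsq : Squarefree n) {p q : ℕ} (hp : p.Prime) (hq : q.Prime) (hpq : p ≠ q) (hn : n = 2 * 3 * p * q) (hp24 : p % 24 = 1) (hq24 : q % 24 = 1)
    (hleg : jacobiSym p q = -1)
    (hr : haveI := isElliptic_congruentNumberCurve hsq.ne_zero; (congruentNumberCurve n).analyticRank = 1)
    (D : GenusPointData n) (hPr : D.Printed) (hV : D.CMPointRingClassFrobeniusValuePrinted)
    {x y : ℚ} (hxy : (congruentNumberCurve n).toAffine.Nonsingular x y)
    (hgen : haveI := isElliptic_congruentNumberCurve hsq.ne_zero;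
      ∀ P, ∃ k : ℤ, IsOfFinAddOrder (P - k • (Point.some x y hxy : (congruentNumberCurve n).toAffine.Point)))
    (hx : ¬ ∃ r : ℚ, x = r ^ 2 ∨ x = -r ^ 2 ∨ x = n * r ^ 2 ∨ x = -(n * r ^ 2))
    (hx2 : ¬ ∃ r : ℚ, x = 2 * r ^ 2 ∨ x = -(2 * r ^ 2) ∨ x = 2 * n * r ^ 2 ∨ x = -(2 * n * r ^ 2)) :
    ∀ L : ℤ, IsScriptL n L → (2 : ℤ) ∣ L := by
  have hn0 : n ≠ 0 := hsq.ne_zero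
  have hnn : n ∈ n.divisors := Nat.mem_divisors_self n hn0
  have hp8 : p % 8 = 1 := by omega
  have hq8 : q % 8 = 1 := by omega
  have h6 : n % 8 = 6 := by
    rw [hn, show 2 * 3 * p * q = 6 * (p * q) by ring, Nat.mul_mod, Nat.mul_mod p q, hp8, hq8]
  have hdvdn : ∀ {d : ℕ}, d ∈ n.divisors → d ∣ 2 * 3 * p * q := fun hd => hn ▸ Nat.dvd_of_mem_divisors hd
  obtain ⟨hLs, -, hrec, -, h35, -, -, -, h318, -, -⟩ := hPr
  obtain ⟨z, Φ, ΓH, ΓH', σ, θ, c, ρ₂, ρ₄, hc, hb⟩ := hV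
  -- the top witness: the pair `φ_p φ_q`
  obtain ⟨φ₁, φ₂, ⟨h₁K, -, h₁i, h₁r⟩, ⟨h₂K, -, h₂i, h₂r⟩, hee, heH⟩ :=
    exists_pairWitness_of_clauses D hsq hb hnn h6 hp hq hpq (hn ▸ ⟨2 * 3 * q, by ring⟩) (hn ▸ ⟨2 * 3 * p, by ring⟩)
      (by omega) (by omega)
  have heL : D.TrivialOnL n (φ₁ * φ₂) := trivialOnL_pair D hsq hp hq hpq hn hp24 hq24 hleg h₁K h₁i h₁r h₂K h₂i h₂r
  refine two_dvd_scriptL_of_coefficients_even_of_x_not_mem D hGZK hsq h6 hr hrec h35 hLs h318 z Φ ΓH ΓH' σ c hc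
    (fun d hd => ⟨(hb d hd).1, (hb d hd).2.2.1⟩) ⟨φ₁ * φ₂, heL, hee, heH⟩ (fun d hd hd6 hdn => ?_) (fun d hd hd5 => ?_) hxy hgen hx hx2
  · -- proper even blocks `6`, `6p`, `6q`
    rcases (divisors_six_mul hp hq hp8 hq8 (hdvdn hd)).2 hd6 with rfl | rfl | rfl | rfl
    · exact Or.inl ⟨3, Nat.prime_three, rfl⟩
    · refine Or.inr (Or.inr ?_)
      rw [show n / (2 * 3 * p) = q by rw [hn]; exact Nat.mul_div_cancel_left q (by have := hp.pos; omega)]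
      exact even_scriptL_of_prime_one_mod_eight h11 D hLs hq hq8 (Nat.mem_divisors.mpr ⟨hn ▸ ⟨2 * 3 * p, by ring⟩, hn0⟩)
    · refine Or.inr (Or.inr ?_)
      rw [show n / (2 * 3 * q) = p by rw [hn, show 2 * 3 * p * q = (2 * 3 * q) * p by ring]; exact Nat.mul_div_cancel_left p (by have := hq.pos; omega)]
      exact even_scriptL_of_prime_one_mod_eight h11 D hLs hp hp8 (Nat.mem_divisors.mpr ⟨hn ▸ ⟨2 * 3 * q, by ring⟩, hn0⟩)
    · exact absurd hn.symm hdn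
  · exact absurd hd5 (divisors_six_mul hp hq hp8 hq8 (hdvdn hd)).1

/-- **THE LOWER HALF ON THE CELL `n = 6pq` FROM THE NAMED FACTS** (`OfFacts` shape, by-name closable): `(tyz_cmPointRingClassFrobeniusValueData ∧
thm11_parity_of_scriptL ∧ GZK)` implies — for all primes `p ≠ q` with `p ≡ q ≡ 1 (mod 24)`, `(p/q) = −1`, `n = 6pq` square-free, `ord_{s=1} L(E_n, s) = 1`,
and a generator `R = (x, y)` of `E_n(ℚ)` modulo torsion with `x ∉ {±1, ±2, ±n, ±2n}·ℚ^{×2}` — `2 ∣ L` whenever `𝓛(n)² = L²`.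
[cite: TianYuanZhang2017, Thm. 1.1, §1, §3, Prop. 3.2 (2)] [cite: Cox2013, §5.C Cor. 5.25, §9.A] [cite: HeathBrown1994SelmerCongruentII, §1] [cite: Darmon2004, Thm. 3.22] -/
theorem two_dvd_scriptL_six_pq_of_facts :
    (tyz_cmPointRingClassFrobeniusValueData ∧ thm11_parity_of_scriptL ∧ rank_eq_analyticRank_of_analyticRank_le_one) →
      ∀ n p q : ℕ, (hsq : Squarefree n) → p.Prime → q.Prime → p ≠ q → n = 2 * 3 * p * q → p % 24 = 1 → q % 24 = 1 → jacobiSym p q = -1 →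
        (haveI := isElliptic_congruentNumberCurve hsq.ne_zero; (congruentNumberCurve n).analyticRank = 1) →
        ∀ (x y : ℚ) (hxy : (congruentNumberCurve n).toAffine.Nonsingular x y),
          (haveI := isElliptic_congruentNumberCurve hsq.ne_zero;
            ∀ P, ∃ k : ℤ, IsOfFinAddOrder (P - k • (Point.some x y hxy : (congruentNumberCurve n).toAffine.Point))) →
          (¬ ∃ r : ℚ, x = r ^ 2 ∨ x = -r ^ 2 ∨ x = n * r ^ 2 ∨ x = -(n * r ^ 2)) →
          (¬ ∃ r : ℚ, x = 2 * r ^ 2 ∨ x = -(2 * r ^ 2) ∨ x = 2 * n * r ^ 2 ∨ x = -(2 * n * r ^ 2)) →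
            ∀ L : ℤ, IsScriptL n L → (2 : ℤ) ∣ L := by
  intro h n p q hsq hp hq hpq hn hp24 hq24 hleg hr x y hxy hgen hx hx2
  have h6 : n % 8 = 6 := by
    rw [hn, show 2 * 3 * p * q = 6 * (p * q) by ring, Nat.mul_mod, Nat.mul_mod p q, show p % 8 = 1 by omega, show q % 8 = 1 by omega]
  obtain ⟨D, hPr, hV⟩ := h.1 n hsq (Or.inr (Or.inl h6))
  exact two_dvd_scriptL_six_pq_of_valuePrinted h.2.2 h.2.1 hsq hp hq hpq hn hp24 hq24 hleg hr D hPr hV hxy hgen hx hx2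

end Summit.BirchSwinnertonDyer.PrintCf2.SixPQ

end
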